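/-
Copyright (c) 2026 the pub-hodgecm-mathlib formalisation cell (harness21).  Prover seat hodgecm-mathlib-K2E3-p17 (g11), HCML Track B «K2-LIT» ∕ h413
(`stmt-HodgeConjecture-24833`), R90-TF section S3, (U3-F) brick P5 «unit away from the planted place by NORM COUNTING» (OPEN OFFER of the S3 dealer
R90-C12-plan (g2) 2026-09-05T00:09:49Z, memo `R90/R90-C12-plan/g2/DEAL-S3-U3F-SPLIT.v1.md` §1 row P5; taken by name 00:15Z, GO 00:15:10Z).  2026-09-05.
-/
import Mathlib.NumberTheory.NumberField.Norm             -- `𝓞 K`, `Algebra.coe_norm_int`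
import Mathlib.RingTheory.Ideal.Norm.AbsNorm             -- `Ideal.absNorm`, `absNorm_span_singleton`, `absNorm_eq_one_iff`, `absNorm_mem`
import Mathlib.RingTheory.DedekindDomain.AdicValuation   -- `HeightOneSpectrum.intValuation`, `valuation`, `intValuation_eq_one_iff`, `intValuation_le_pow_iff_dvd`
import HarnessLib

/-!
# R90-TF · S3 · THEOREMS — `R90S3UnitAwayFromPlantedPlace` ((U3-F) brick P5): if ONE prime power `𝔭ⁿ ∣ (α)` already has the absolute norm of `(α)`,
# then `α` is a unit at every other finite place; and `|N(α)| = pᵃ` makes `α` a unit at every finite place not over `p`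

R90-TF section S3 (dealer R90-C12-plan (g2), planner split `DEAL-S3-U3F-SPLIT.v1.md` §1 row P5 «NORM COUNTING replaces the place↔factor dictionary»);
crux H413 (`stmt-HodgeConjecture-24833`, lane `--supports … --as helper`), route `HCCMUnconditional`.  Serves the ⟪U⟫-field clause of the ℚ-PLANTED road
behind the socket `stub_R90_S3_auxGlobaliseField` (`Cruxes/H413/Lines/R90_S3_LocalTransportWaveG.lean` :645): the planted generator `α ∈ 𝓞 F′` has
`|N_{F′∕ℚ}(α)| = pᵃ` (P3: `f(0) = ±pᵃ` exact), and the planted place `v′ ∣ p` carries `absNorm v′ ^ n = pᵃ` with `𝔭_{v′}ⁿ ∣ (α)` (`n` = the `v′`-exponent of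
`(α)`; supplied by the assembly P8 from P1 + P9); CONCLUSION: `α` is a `U`-unit at every finite `U ≠ v′` — the input of P6 (`UnramifiedOfUnitRadicand`).  No
factorisation dictionary is used: only multiplicativity and monotonicity of `Ideal.absNorm`.  PURE MATHLIB; THEOREMS ONLY (no `def`, no `instance`, no
notation, no named fact, no `sorry`); never imports `Cruxes/…/Lines`.

THE MATHEMATICS [folklore].  Let `S` be a Dedekind domain, free of finite rank over `ℤ` (e.g. `S = 𝓞 K`), `𝔭 ≠ 𝔮` nonzero primes, `𝔭ⁿ ∣ (α)` and
`N(α) := absNorm (α) = N𝔭ⁿ`.  If `α ∈ 𝔮` then `𝔮 ∣ (α)`, and `𝔭ⁿ`, `𝔮` are coprime, so `𝔭ⁿ𝔮 ∣ (α)`; taking absolute norms (a monoid-with-zero hom,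
Mathlib `Ideal.absNorm`) `N𝔭ⁿ · N𝔮 ∣ N(α) = N𝔭ⁿ`, and `N𝔭ⁿ ≠ 0`, whence `N𝔮 = 1`, i.e. `𝔮 = S` (Mathlib `Ideal.absNorm_eq_one_iff`) — absurd.  Hence
`α ∉ 𝔮`, i.e. `v_𝔮(α) = 0` (Mathlib `intValuation_eq_one_iff`, `valuation_eq_one_iff_notMem`).  Likewise, if `N(α) = pᵃ` with `p` prime and `α ∈ 𝔮` then
`N𝔮 ∣ pᵃ`, so `N𝔮 = pᵇ` with `b ≥ 1` (`𝔮 ≠ S`), and `N𝔮 ∈ 𝔮` (Mathlib `Ideal.absNorm_mem`) gives `pᵇ ∈ 𝔮`, so `p ∈ 𝔮`: `𝔮` lies over `p`.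
* §1 (any such `S`) **`not_mem_of_pow_dvd_of_absNorm_eq`** (the one-place-eats-the-norm lemma) with currencies `intValuation_eq_one_of_pow_dvd_of_absNorm_eq`,
  `valuation_eq_one_of_pow_dvd_of_absNorm_eq` (fraction field), the `intValuation`-exponent entry `not_mem_of_intValuation_eq_of_absNorm_eq`, and the
  prime-power wrapper `not_mem_of_pow_dvd_of_absNorm_eq_prime_pow`; **`natCast_mem_of_mem_of_absNorm_eq_prime_pow`** ∕ `not_mem_of_absNorm_eq_prime_pow_of_natCast_not_mem`
  (the «not over `p` ⇒ unit» half).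
* §2 (`S = 𝓞 K`, `K` a number field) the bridge `absNorm_span_singleton_eq_of_abs_norm_eq` from `|Algebra.norm ℚ (α : K)| = m`, and the two packaged forms the
  assembly P8 consumes: **`valuation_eq_one_of_ne_plantedPlace`** (every finite `U ≠ v′`) and **`valuation_eq_one_of_not_over_p`** (every finite `U` with `p ∉ U`).

HONEST LABEL: HC_CM is proved only modulo the 7 printed citations (2 remaining named inputs: hLiu418 = stmt-HodgeConjecture-24832, h413 =
stmt-HodgeConjecture-24833) until rung 0 closes; elementary algebraic number theory for a sub-step of a GENUINE residual ((U3-F)); proves nothing printed;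
count-neutral.

## References
* [Rogawski1990] J. D. Rogawski, *Automorphic Representations of Unitary Groups in Three Variables*, Ann. of Math. Stud. 123 (1990), §13.8 p. 216 (context:
  the auxiliary global field of the globalisation argument).
* [CasselsFrohlichANT1967] J. W. S. Cassels, A. Fröhlich (eds.), *Algebraic Number Theory* (1967), Ch. I §§4–5 (Dedekind domains: unique factorisation of
  ideals, the ideal norm is multiplicative).
-/

set_option autoImplicit false
-- the mandated namespace repeats the single-problem summit's segment (`HodgeConjecture.HodgeConjecture`)
set_option linter.dupNamespace false

noncomputable section

namespace Summit.HodgeConjecture.HodgeConjecture.R90.S3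

open IsDedekindDomain IsDedekindDomain.HeightOneSpectrum NumberField

/-! ## §1 One prime power with the full norm ⇒ unit at every other height-one prime (any Dedekind domain free of finite rank over `ℤ`) -/

section Dedekind

variable {S : Type*} [CommRing S] [IsDedekindDomain S] [Module.Free ℤ S] [Module.Finite ℤ S]

/-- **One place eats the norm.**  If `𝔭ⁿ ∣ (α)` and `absNorm (α) = absNorm 𝔭 ^ n` for a height-one prime `𝔭 = v.asIdeal`, then `α ∉ 𝔮` for every height-one
prime `𝔮 = U.asIdeal` with `U ≠ v` (coprimality `𝔭ⁿ𝔮 ∣ (α)`, multiplicativity of `Ideal.absNorm`, `absNorm 𝔮 = 1 ↔ 𝔮 = ⊤`). [folklore] -/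
theorem not_mem_of_pow_dvd_of_absNorm_eq (v : HeightOneSpectrum S) {α : S} {n : ℕ} (hn : v.asIdeal ^ n ∣ Ideal.span {α})
    (hN : Ideal.absNorm (Ideal.span {α}) = Ideal.absNorm v.asIdeal ^ n) (U : HeightOneSpectrum S) (hU : U ≠ v) : α ∉ U.asIdeal := by
  intro hα
  have hUdvd : U.asIdeal ∣ Ideal.span {α} := Ideal.dvd_span_singleton.mpr hα
  have hne : v.asIdeal ≠ U.asIdeal := fun h => hU (HeightOneSpectrum.ext h.symm)
  have hcop : IsCoprime (v.asIdeal ^ n) U.asIdeal :=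
    (Ideal.isCoprime_iff_sup_eq.mpr (v.isMaximal.coprime_of_ne U.isMaximal hne)).pow_left
  have hdvd : v.asIdeal ^ n * U.asIdeal ∣ Ideal.span {α} := hcop.mul_dvd hn hUdvd
  have h : Ideal.absNorm v.asIdeal ^ n * Ideal.absNorm U.asIdeal ∣ Ideal.absNorm v.asIdeal ^ n * 1 := by
    simpa only [map_mul, map_pow, hN, mul_one] using map_dvd Ideal.absNorm hdvd
  have hv0 : 0 < Ideal.absNorm v.asIdeal ^ n :=
    pow_pos (Nat.pos_of_ne_zero (by rw [Ne, Ideal.absNorm_eq_zero_iff]; exact v.ne_bot)) n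
  have hU1 : Ideal.absNorm U.asIdeal = 1 := Nat.dvd_one.mp ((Nat.mul_dvd_mul_iff_left hv0).mp h)
  exact U.isPrime.ne_top (Ideal.absNorm_eq_one_iff.mp hU1)

/-- `intValuation` currency of `not_mem_of_pow_dvd_of_absNorm_eq`: `v_U(α) = 1` (i.e. exponent `0`) at every `U ≠ v`. [folklore] -/
theorem intValuation_eq_one_of_pow_dvd_of_absNorm_eq (v : HeightOneSpectrum S) {α : S} {n : ℕ} (hn : v.asIdeal ^ n ∣ Ideal.span {α})
    (hN : Ideal.absNorm (Ideal.span {α}) = Ideal.absNorm v.asIdeal ^ n) (U : HeightOneSpectrum S) (hU : U ≠ v) : U.intValuation α = 1 :=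
  intValuation_eq_one_iff.mpr (not_mem_of_pow_dvd_of_absNorm_eq v hn hN U hU)

/-- Fraction-field currency of `not_mem_of_pow_dvd_of_absNorm_eq`: `U.valuation K α = 1` at every `U ≠ v`. [folklore] -/
theorem valuation_eq_one_of_pow_dvd_of_absNorm_eq (K : Type*) [Field K] [Algebra S K] [IsFractionRing S K] (v : HeightOneSpectrum S) {α : S} {n : ℕ}
    (hn : v.asIdeal ^ n ∣ Ideal.span {α}) (hN : Ideal.absNorm (Ideal.span {α}) = Ideal.absNorm v.asIdeal ^ n) (U : HeightOneSpectrum S) (hU : U ≠ v) :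
    U.valuation K (algebraMap S K α) = 1 :=
  (U.valuation_eq_one_iff_notMem (K := K)).mpr (not_mem_of_pow_dvd_of_absNorm_eq v hn hN U hU)

/-- Exponent entry: if `v.intValuation α = exp (−n)` (the `v`-exponent of `(α)` is `n`) and `absNorm (α) = absNorm 𝔭_v ^ n`, then `α ∉ U.asIdeal` for every
`U ≠ v` (Mathlib `intValuation_le_pow_iff_dvd` turns the exponent into `𝔭ⁿ ∣ (α)`). [folklore] -/
theorem not_mem_of_intValuation_eq_of_absNorm_eq (v : HeightOneSpectrum S) {α : S} {n : ℕ} (hval : v.intValuation α = WithZero.exp (-(n : ℤ)))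
    (hN : Ideal.absNorm (Ideal.span {α}) = Ideal.absNorm v.asIdeal ^ n) (U : HeightOneSpectrum S) (hU : U ≠ v) : α ∉ U.asIdeal :=
  not_mem_of_pow_dvd_of_absNorm_eq v ((v.intValuation_le_pow_iff_dvd α n).mp hval.le) hN U hU

/-- Prime-power wrapper (the memo's letters): `absNorm (α) = pᵃ`, `absNorm 𝔭_v ^ n = pᵃ`, `𝔭_vⁿ ∣ (α)` ⇒ `α ∉ U.asIdeal` for every `U ≠ v` (`p` need not be
prime here). [folklore] -/
theorem not_mem_of_pow_dvd_of_absNorm_eq_prime_pow (v : HeightOneSpectrum S) {α : S} {p a n : ℕ} (hN : Ideal.absNorm (Ideal.span {α}) = p ^ a)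
    (hv : Ideal.absNorm v.asIdeal ^ n = p ^ a) (hn : v.asIdeal ^ n ∣ Ideal.span {α}) (U : HeightOneSpectrum S) (hU : U ≠ v) : α ∉ U.asIdeal :=
  not_mem_of_pow_dvd_of_absNorm_eq v hn (hN.trans hv.symm) U hU

omit [Module.Finite ℤ S] in
/-- **A prime containing `α` with `absNorm (α) = pᵃ` lies over `p`.**  If `absNorm (α) = pᵃ` (`p` prime) and `α ∈ 𝔮 = U.asIdeal` then `(p : S) ∈ 𝔮`
(`absNorm 𝔮 ∣ pᵃ` is a positive power of `p`, and `absNorm 𝔮 ∈ 𝔮` by Mathlib `Ideal.absNorm_mem`). [folklore] -/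
theorem natCast_mem_of_mem_of_absNorm_eq_prime_pow {α : S} {p a : ℕ} (hp : p.Prime) (hN : Ideal.absNorm (Ideal.span {α}) = p ^ a)
    (U : HeightOneSpectrum S) (hα : α ∈ U.asIdeal) : (p : S) ∈ U.asIdeal := by
  have hdvd : Ideal.absNorm U.asIdeal ∣ p ^ a := hN ▸ map_dvd Ideal.absNorm (Ideal.dvd_span_singleton.mpr hα)
  obtain ⟨b, -, hb⟩ := (Nat.dvd_prime_pow hp).mp hdvd
  have hb0 : b ≠ 0 := by
    rintro rfl
    exact U.isPrime.ne_top (Ideal.absNorm_eq_one_iff.mp (by simpa using hb))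
  have hmem : ((p : S) ^ b) ∈ U.asIdeal := by
    have h := Ideal.absNorm_mem U.asIdeal
    rwa [hb, Nat.cast_pow] at h
  exact U.isPrime.mem_of_pow_mem b hmem

omit [Module.Finite ℤ S] in
/-- **Not over `p` ⇒ unit.**  If `absNorm (α) = pᵃ` (`p` prime) and `(p : S) ∉ U.asIdeal` then `α ∉ U.asIdeal`. [folklore] -/
theorem not_mem_of_absNorm_eq_prime_pow_of_natCast_not_mem {α : S} {p a : ℕ} (hp : p.Prime) (hN : Ideal.absNorm (Ideal.span {α}) = p ^ a)
    (U : HeightOneSpectrum S) (hU : (p : S) ∉ U.asIdeal) : α ∉ U.asIdeal :=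
  fun hα => hU (natCast_mem_of_mem_of_absNorm_eq_prime_pow hp hN U hα)

omit [Module.Finite ℤ S] in
/-- `intValuation` currency of the «not over `p`» half. [folklore] -/
theorem intValuation_eq_one_of_absNorm_eq_prime_pow_of_natCast_not_mem {α : S} {p a : ℕ} (hp : p.Prime)
    (hN : Ideal.absNorm (Ideal.span {α}) = p ^ a) (U : HeightOneSpectrum S) (hU : (p : S) ∉ U.asIdeal) : U.intValuation α = 1 :=
  intValuation_eq_one_iff.mpr (not_mem_of_absNorm_eq_prime_pow_of_natCast_not_mem hp hN U hU)

end Dedekind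

/-! ## §2 Number-field packaging (`S = 𝓞 K`): from `|N_{K∕ℚ}(α)| = m` and the planted place -/

section NumberField

variable {K : Type*} [Field K] [NumberField K]

/-- **Bridge from the field norm.**  For `α ∈ 𝓞 K`: `|Algebra.norm ℚ (α : K)| = m` (`m : ℕ`) ⇒ `absNorm (α) = m` (Mathlib `Ideal.absNorm_span_singleton`,
`Algebra.coe_norm_int`). [folklore] -/
theorem absNorm_span_singleton_eq_of_abs_norm_eq (α : 𝓞 K) {m : ℕ} (h : |Algebra.norm ℚ (α : K)| = m) :
    Ideal.absNorm (Ideal.span {α}) = m := by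
  rw [Ideal.absNorm_span_singleton]
  have h' : (((Algebra.norm ℤ α).natAbs : ℤ) : ℚ) = (m : ℚ) := by
    rw [Int.natCast_natAbs, Int.cast_abs, Algebra.coe_norm_int, h]
  exact_mod_cast h'

/-- **Unit away from the planted place** (the P5 head the assembly P8 consumes).  `α ∈ 𝓞 K` with `|N_{K∕ℚ}(α)| = pᵃ`, a finite place `v` with
`absNorm 𝔭_v ^ n = pᵃ` and `𝔭_vⁿ ∣ (α)` ⇒ `U.valuation K α = 1` for every finite place `U ≠ v`. [folklore] -/
theorem valuation_eq_one_of_ne_plantedPlace (α : 𝓞 K) {p a n : ℕ} (hN : |Algebra.norm ℚ (α : K)| = (p ^ a : ℕ)) (v : HeightOneSpectrum (𝓞 K))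
    (hv : Ideal.absNorm v.asIdeal ^ n = p ^ a) (hn : v.asIdeal ^ n ∣ Ideal.span {α}) (U : HeightOneSpectrum (𝓞 K)) (hU : U ≠ v) :
    U.valuation K (α : K) = 1 :=
  (U.valuation_eq_one_iff_notMem (K := K)).mpr
    (not_mem_of_pow_dvd_of_absNorm_eq_prime_pow v (absNorm_span_singleton_eq_of_abs_norm_eq α hN) hv hn U hU)

/-- `𝓞 K`-membership currency of `valuation_eq_one_of_ne_plantedPlace`: `α ∉ U.asIdeal` for every finite `U ≠ v`. [folklore] -/
theorem not_mem_of_ne_plantedPlace (α : 𝓞 K) {p a n : ℕ} (hN : |Algebra.norm ℚ (α : K)| = (p ^ a : ℕ)) (v : HeightOneSpectrum (𝓞 K))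
    (hv : Ideal.absNorm v.asIdeal ^ n = p ^ a) (hn : v.asIdeal ^ n ∣ Ideal.span {α}) (U : HeightOneSpectrum (𝓞 K)) (hU : U ≠ v) : α ∉ U.asIdeal :=
  not_mem_of_pow_dvd_of_absNorm_eq_prime_pow v (absNorm_span_singleton_eq_of_abs_norm_eq α hN) hv hn U hU

/-- **Unit at every place not over `p`.**  `α ∈ 𝓞 K` with `|N_{K∕ℚ}(α)| = pᵃ` (`p` prime) ⇒ `U.valuation K α = 1` for every finite place `U` with
`(p : 𝓞 K) ∉ U.asIdeal`. [folklore] -/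
theorem valuation_eq_one_of_not_over_p (α : 𝓞 K) {p a : ℕ} (hp : p.Prime) (hN : |Algebra.norm ℚ (α : K)| = (p ^ a : ℕ))
    (U : HeightOneSpectrum (𝓞 K)) (hU : (p : 𝓞 K) ∉ U.asIdeal) : U.valuation K (α : K) = 1 :=
  (U.valuation_eq_one_iff_notMem (K := K)).mpr
    (not_mem_of_absNorm_eq_prime_pow_of_natCast_not_mem hp (absNorm_span_singleton_eq_of_abs_norm_eq α hN) U hU)

/-- A finite place containing the planted generator lies over `p`: `|N_{K∕ℚ}(α)| = pᵃ`, `α ∈ U.asIdeal` ⇒ `(p : 𝓞 K) ∈ U.asIdeal`. [folklore] -/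
theorem natCast_mem_of_mem_of_abs_norm_eq_prime_pow (α : 𝓞 K) {p a : ℕ} (hp : p.Prime) (hN : |Algebra.norm ℚ (α : K)| = (p ^ a : ℕ))
    (U : HeightOneSpectrum (𝓞 K)) (hα : α ∈ U.asIdeal) : (p : 𝓞 K) ∈ U.asIdeal :=
  natCast_mem_of_mem_of_absNorm_eq_prime_pow hp (absNorm_span_singleton_eq_of_abs_norm_eq α hN) U hα

end NumberField

end Summit.HodgeConjecture.HodgeConjecture.R90.S3

end
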